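import Summits.QuantumFields.YangMills.Theorems.BalabanUVNodesN11NodeFacesOfSupplyChainTokens
import Summits.QuantumFields.YangMills.Theorems.BalabanUVNodesN11K1WitnessGaussPinH

/-!
# DAG node N11 — THE STEP-WINDOW TOKEN SOCKETS AT THE WITNESS FAMILIES: N11's node ∕ `B16.Thm1Printed` ∕ the `h11`-shaped (S1ᵀ) family from
# `hN : ∀ P, Step.InInterval γ′ P.K (gOfRecord₁₃ θ P) → SupplyChainAt θ P` at ANY H-extension of a live re-pin, of K0a's all-numerics witness, of K1's witness of record
# `θ₁₅ᶜᶜᴹᵂ(j; γ)` (window `0 < γ ≤ ½` + six signs ONLY), and at dag-n11-w6's certificate `θᴳ := gaussPinH (ofHistoryBlind ⟨θ₁₅ᶜᶜᴹᵂ, Zr⟩)` — plus the CONTINUITY-ROAD child at `θᴳ`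

HEADER — WORK-UNIT METADATA.  Cell `pub-ymgap`, YM-PLAN Track A (HUMAN RULING D-0062 ∕ D-0149 width seats), seat `pub-ymgap-dag-n11-w1` (g4; WIDTH SEAT 1 of 4 on NODE
n11 [B14]), route `BalabanUVNodes` rev 29, KEY item K1⁹ `StabilityBRunRowsAtRecordR13SepCoPHV` = stmt-QuantumFields-27364 (dag-lead KEY MAP v2; helper lane, `--kind proof
--supports 27364 --as helper`, count-neutral; seat payload key K1⁷ 20542 = MIS-KEY fallback).  [III] = [Balaban1988Convergent], [V] = [Balaban1989LargeFieldII], [IV] =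
[Balaban1989LargeFieldI], [I] = [Balaban1987RG1].  Over this seat's `…N11NodeFacesOfSupplyChainTokens` (the road-agnostic sockets `b14_main_leavesP_all_of_supplyChainAt_family`,
`thm1Printed_datumOfRecord₁₃CoPH_of_supplyChainAt_family`, `h11Family_of_supplyChainAt_family`, and the continuity-road token family `supplyChainAt_family_of_gaussCert_of_continuous`),
dag-n11-e `…Sect3SupplyChainNodeAtNumerics` (the live re-pin ∕ numerics ∕ `θ₁₅ᶜᶜᴹᵂ` letter discharges: selector `rfl`, `Admissible.liveRepin₁₃`, `admissible_theta13OfNumerics`,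
`stage12NumericsOfThm1CCMW_pos_of_le_half`, `one_le_M_stage12NumericsOfThm1CCMW`; numerals `κ = 2·10⁴`, `E₀ = B₀ = 1`), dag-n11-w6 `…N11K1WitnessGaussPinH` (p-landed: `θᴳ`'s `rfl`
faces) and this seat's `…GaussianCertificateDefs` (`gaussPinH_ζ0 ∕ _quad`, `provisos₁₃CoPH_gaussPinH`).

WHY THIS FILE.  The K1 roads read N11 at WITNESSES: K1⁹ v9's stub-1 world is bound to the datum of a tuple of K0's witness family, and dag-n24-c's K1⁹-by-name road asks the
`h11`-shaped child at `θᴴ = ofHistoryBlind ⟨θ₁₅ᶜᶜᴹᵂ(j;γ), Zr⟩` resp. (dag-n11-w6's switch) at the certificate `θᴳ = gaussPinH θᴴ`.  At those tuples the live-selector clause is `rfl`,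
admissibility is K0a's ∕ dag-n21-c's theorem and the three signs + `1 ≤ M` are numerals — dag-n11-e's `…NodeAtNumerics` discharged them for the ALL-RUNS token binder
`∀ P, SupplyChainAt θ P` (window unread).  The supplier roads, however, deliver the token ONLY ON WINDOWED RUNS ([III] §3's bounds need small couplings): the faithful binder is the
STEP-WINDOW family `hN : ∀ P, Step.InInterval γ′ P.K (gOfRecord₁₃ θ P) → SupplyChainAt θ P`.  THIS FILE carries this seat's road-agnostic sockets to the witness families with every
θ-level letter discharged BY NAME: (§1) any H-extension of a live re-pin; (§2) K0a's all-numerics family; (§3) K1's witness `θ₁₅ᶜᶜᴹᵂ(j; γ)` — window `0 < γ ≤ ½` + six signs only;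
(§4) `θᴳ`: the `h11` child in dag-n24-c's binder shape VERBATIM from the windowed token family (any door proof `hG`), and its CONTINUITY-ROAD edition — N11's K1-road child at K1's
witness certificate from, per windowed run, [III] §3's supplier with `SupplierObligations` and continuous bounded terms, NOTHING ELSE displayed but the door key.

WHAT THIS FILE PROVES (theorems only, 0 `def`, 0 `sorry`; standard axioms; compositions BY NAME).
§1 ★ `b14_main_leavesP_all_liveRepinH_of_supplyChainAt_family` · ★ `thm1Printed_datumOfRecord₁₃CoPH_liveRepinH_of_supplyChainAt_family` · ★★ `h11Family_liveRepinH_of_supplyChainAt_family`.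
§2 the same three at `theta13LiveOfNumerics F N n ε₂₉ ζ Rz Zt` (`…_theta13LiveOfNumericsH_…`).
§3 the same three at K1's witness `theta13OfThm1CCMW F N j γ ε₀ ε₂₉ B₃ B₃' a₀ a₁` (`…_theta13OfThm1CCMWH_…`).
§4 ★★★ `h11Family_gaussPinH_ofHistoryBlind_theta13OfThm1CCMW_of_supplyChainAt_family` · ★★★ `h11Family_gaussPinH_ofHistoryBlind_theta13OfThm1CCMW_of_continuous` ·
   ★★ `b14_main_leavesP_all_gaussPinH_ofHistoryBlind_theta13OfThm1CCMW_of_continuous`.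

HONEST FRAMING.  Helper lane of K1⁹; count-neutral KERNEL COMPOSITION of landed theorems (every proof is one application after the `rfl` substitution of the Stage-13 part); the token
family, resp. (§4) `SupplierObligations` ([III] §3 ∕ Thm 2 proper — XL, nobody's theorem) + the continuity ∕ bound rows, and the door key `hG` ∕ `hrec` are DISPLAYED HYPOTHESES;
nothing of Bałaban asserted; no statement that any witness carries the rows.  No v9 stub touched; K1⁹ NOT closed; N11 NOT discharged; counts unmoved (typed 28∕28 · discharged 5∕27 ·
A 5∕28).  One finite `𝕋⁴_{L^K}` programme at fixed `ε = L^{−K}`; R4 closes only the conditional finite-𝕋⁴ rung `BalabanLadder.UV` — NOT ℝ⁴, NOT OS, NOT a mass gap, NOT Clay.  No `sorry`,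
`axiom`, `def`, `instance`, `notation`.
Sources (SHAPE ∕ bookkeeping only): [III] Thm 1 p.262, Theorem p.245, remark p.262, p.244 L36–38, §3 p.279, (2.4)–(2.6) p.255, (2.10) p.256, (3.16)–(3.22) pp.268–269, (3.23)–(3.25)
p.270; [V] Thm 1 + (0.1) pp.355–356; [IV] (0.3)–(0.4) p.176, p.177 (i)–(ii); [I] Thm 1 p.259, (0.20) p.256.
-/

noncomputable section

open MeasureTheory TopologicalSpace
open scoped BigOperators ENNReal NNReal Matrix.Norms.L2Operator

namespace Summit.QuantumFields.YangMills.Theorems.BalabanUVNodesN11NodeFacesOfSupplyChainTokensAtWitness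

open Literature.MathematicalPhysics.QuantumFieldTheory.Balaban1983to89 T4Continuum T4NestedCovariance Node00 Node00.Tk DagBinding
open B15DeterminingSets B8Eq17ClassAkV1 B14.Eq218Concrete B10Eq42TorusConstraint Step
open BalabanUVNodesN11HistoryPinnedResidualDefs BalabanUVNodesN11RePinnedParamDefs
open BalabanUVNodesN11GaussianCertificateDefs (gaussPinH gaussPinH_ζ0 gaussPinH_quad provisos₁₃CoPH_gaussPinH)
open BalabanUVNodesN11Sect3SupplyChainDefs
open BalabanUVNodesN11Sect3SupplyChainObligationsDefs
open BalabanUVNodesN11Sect3SupplyChainNodeAtNumerics (one_le_M_stage12NumericsOfThm1CCMW)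
open BalabanUVNodesN11NodeFacesOfSupplyChainTokens

variable {F : T4Family} {N : ℕ} [NeZero N]

/-! ## §1  At any H-extension of a live re-pin `θ₀.liveRepin₁₃ F N`: selector `rfl`, admissibility `hθ₀.liveRepin₁₃`, signs and `1 ≤ M` read off `θ₀` -/

section Repin

variable {θ₀ : Stage13Params F N} {θ : Stage13HParams F N}

/-- **★ N11's DAG NODE AT EVERY RUN, AT ANY H-EXTENSION OF A LIVE RE-PIN, FROM A FAMILY OF TOKENS ON THE STEP WINDOW `]0, γ′]`** — at any world bound to the CoPH datum of `θ`
(`hrec` the key) with `w.γ ≤ γ′`; the selector clause is `rfl` at the re-pin, admissibility is `hθ₀.liveRepin₁₃`, the three signs and `1 ≤ M` are `θ₀`'s (this seat's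
`b14_main_leavesP_all_of_supplyChainAt_family` after the `rfl` substitution of the Stage-13 part). [cite: Balaban1988Convergent, Thm 1 p.262, Theorem p.245, p.244 L36–38, §3 p.279, (3.22) p.269; Balaban1989LargeFieldII, Introduction pp.355–356; Balaban1989LargeFieldI, (0.3)–(0.4) p.176, p.177 (i)–(ii)] -/
theorem b14_main_leavesP_all_liveRepinH_of_supplyChainAt_family (hθ : θ.toStage13Params = θ₀.liveRepin₁₃ F N) (hθ₀ : θ₀.Admissible F N)
    (hκ : 0 ≤ θ₀.s2.lf.κ) (hE₀ : 0 ≤ θ₀.s2.lf.E₀) (hB₀ : 0 ≤ θ₀.s2.lf.B₀) (hM : 1 ≤ θ₀.τ9.M) (hrec : θ.Provisos₁₃CoPH F N) {γ' : ℝ}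
    (hN : ∀ P : B12.RunParams, Step.InInterval γ' P.K (gOfRecord₁₃ F N θ.toStage13Params P) → SupplyChainAt θ P)
    (w : WorldP) (hC : w.C = (datumOfRecord₁₃CoPH F N θ hrec).C) (hγw : w.γ ≤ γ') : ∀ P : B12.RunParams, Dag.B14_main (leavesP w P) := by
  obtain ⟨⟨θ₁, Zr⟩, Zh, Phih⟩ := θ
  obtain rfl : θ₁ = _ := hθ
  exact b14_main_leavesP_all_of_supplyChainAt_family _ hrec rfl hθ₀.liveRepin₁₃ hκ hE₀ hB₀ hM hN w hC hγw

/-- **★ `B16.Thm1Printed (datumOfRecord₁₃CoPH F N θ hrec).C` AT ANY H-EXTENSION OF A LIVE RE-PIN FROM A FAMILY OF TOKENS ON THE STEP WINDOW `]0, γ′]`, `0 < γ′`.**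
[cite: Balaban1988Convergent, Thm 1 p.262, Theorem p.245, p.244 L36–38, §3 p.279, (3.16) p.268; Balaban1989LargeFieldII, Thm 1 p.355; Balaban1989LargeFieldI, (0.3)–(0.4) p.176, p.177 (i)–(ii)] -/
theorem thm1Printed_datumOfRecord₁₃CoPH_liveRepinH_of_supplyChainAt_family (hθ : θ.toStage13Params = θ₀.liveRepin₁₃ F N) (hθ₀ : θ₀.Admissible F N)
    (hκ : 0 ≤ θ₀.s2.lf.κ) (hE₀ : 0 ≤ θ₀.s2.lf.E₀) (hB₀ : 0 ≤ θ₀.s2.lf.B₀) (hM : 1 ≤ θ₀.τ9.M) (hrec : θ.Provisos₁₃CoPH F N) {γ' : ℝ} (hγ' : 0 < γ')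
    (hN : ∀ P : B12.RunParams, Step.InInterval γ' P.K (gOfRecord₁₃ F N θ.toStage13Params P) → SupplyChainAt θ P) :
    B16.Thm1Printed (datumOfRecord₁₃CoPH F N θ hrec).C := by
  obtain ⟨⟨θ₁, Zr⟩, Zh, Phih⟩ := θ
  obtain rfl : θ₁ = _ := hθ
  exact thm1Printed_datumOfRecord₁₃CoPH_of_supplyChainAt_family _ hrec rfl hθ₀.liveRepin₁₃ hκ hE₀ hB₀ hM hγ' hN

/-- **★★ THE `h11`-SHAPED (S1ᵀ) FAMILY AT THE SepCoPH DATUM OF ANY H-EXTENSION OF A LIVE RE-PIN FROM A FAMILY OF TOKENS ON THE STEP WINDOW `]0, γ′]`, `0 < γ′`** (`γ₁₁ := γ′`;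
only `smallCouplings` read). [cite: Balaban1988Convergent, Theorem p.245, Thm 1 p.262, remark p.262, p.244 L36–38, §3 p.279, (2.6) p.255; Balaban1989LargeFieldII, Thm 1 + (0.1) pp.355–356; Balaban1989LargeFieldI, (0.3)–(0.4) p.176, p.177 (i)–(ii)] -/
theorem h11Family_liveRepinH_of_supplyChainAt_family (hθ : θ.toStage13Params = θ₀.liveRepin₁₃ F N) (hθ₀ : θ₀.Admissible F N)
    (hκ : 0 ≤ θ₀.s2.lf.κ) (hE₀ : 0 ≤ θ₀.s2.lf.E₀) (hB₀ : 0 ≤ θ₀.s2.lf.B₀) (hM : 1 ≤ θ₀.τ9.M) (hrec : θ.Provisos₁₃SepCoPH F N) {γ' : ℝ} (hγ' : 0 < γ')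
    (hN : ∀ P : B12.RunParams, Step.InInterval γ' P.K (gOfRecord₁₃ F N θ.toStage13Params P) → SupplyChainAt θ P) :
    ∀ βup β₀ : ℝ, ∃ γ₁₁ : ℝ, 0 < γ₁₁ ∧ ∀ w : WorldP, w.C = (datumOfRecord₁₃SepCoPH F N θ hrec).C → w.βup = βup → w.β₀ = β₀ → w.γ ≤ γ₁₁ →
      ∀ P : B12.RunParams, (leavesP w P).b7 → (leavesP w P).b8 → (leavesP w P).b9 → (leavesP w P).b10 → (leavesP w P).b11 →
      (leavesP w P).smallCouplings → (leavesP w P).smallFieldInductive → (leavesP w P).flowControl →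
        ∀ k, k < P.K → SLaw₁₃CoPH F N θ P k → TLaw₁₃CoPH F N θ P k := by
  obtain ⟨⟨θ₁, Zr⟩, Zh, Phih⟩ := θ
  obtain rfl : θ₁ = _ := hθ
  exact h11Family_of_supplyChainAt_family _ hrec rfl hθ₀.liveRepin₁₃ hκ hE₀ hB₀ hM hγ' hN

end Repin

/-! ## §2  At K0a's ALL-NUMERICS witness family `theta13LiveOfNumerics F N n ε₂₉ ζ Rz Zt` (= `(theta13OfNumerics …).liveRepin₁₃`, `rfl`): `n.Pos`, `0 < ε₂₉`, signs and `1 ≤ M` of `n` -/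

section Numerics

variable {n : Stage12Numerics} {ε₂₉ : ℝ} {ζ : ZetaOfRecord F N n.ν n.τ9.M} {Rz : (K : ℕ) → Sect2.Residual (F.P K) (MatA N)}
  {Zt : (K : ℕ) → TkResidualW F N (FluctV N) K} {θ : Stage13HParams F N}

/-- **★ N11's DAG NODE AT EVERY RUN AT ANY H-EXTENSION OF `θ₁₃(n, ε₂₉)` FROM A FAMILY OF TOKENS ON THE STEP WINDOW `]0, γ′]`** (world bound to the CoPH datum, `w.γ ≤ γ′`; K0a's
`admissible_theta13OfNumerics`). [cite: Balaban1988Convergent, Thm 1 p.262, Theorem p.245, p.244 L36–38, §3 p.279, (2.4) p.255, (2.10) p.256; Balaban1989LargeFieldI, (0.3)–(0.4) p.176, p.177 (i)–(ii)] -/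
theorem b14_main_leavesP_all_theta13LiveOfNumericsH_of_supplyChainAt_family (hθ : θ.toStage13Params = theta13LiveOfNumerics F N n ε₂₉ ζ Rz Zt) (hn : n.Pos)
    (hε' : 0 < ε₂₉) (hκ : 0 ≤ n.s2.lf.κ) (hE₀ : 0 ≤ n.s2.lf.E₀) (hB₀ : 0 ≤ n.s2.lf.B₀) (hM : 1 ≤ n.τ9.M) (hrec : θ.Provisos₁₃CoPH F N) {γ' : ℝ}
    (hN : ∀ P : B12.RunParams, Step.InInterval γ' P.K (gOfRecord₁₃ F N θ.toStage13Params P) → SupplyChainAt θ P)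
    (w : WorldP) (hC : w.C = (datumOfRecord₁₃CoPH F N θ hrec).C) (hγw : w.γ ≤ γ') : ∀ P : B12.RunParams, Dag.B14_main (leavesP w P) :=
  b14_main_leavesP_all_liveRepinH_of_supplyChainAt_family (θ₀ := theta13OfNumerics F N n ε₂₉ ζ Rz Zt) hθ (admissible_theta13OfNumerics F N ζ Rz Zt hn hε')
    hκ hE₀ hB₀ hM hrec hN w hC hγw

/-- **★ `B16.Thm1Printed` AT THE CoPH DATUM OF ANY H-EXTENSION OF `θ₁₃(n, ε₂₉)` FROM A FAMILY OF TOKENS ON THE STEP WINDOW `]0, γ′]`, `0 < γ′`.**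
[cite: Balaban1988Convergent, Thm 1 p.262, Theorem p.245, p.244 L36–38, §3 p.279; Balaban1989LargeFieldII, Thm 1 p.355; Balaban1989LargeFieldI, (0.3)–(0.4) p.176] -/
theorem thm1Printed_datumOfRecord₁₃CoPH_theta13LiveOfNumericsH_of_supplyChainAt_family (hθ : θ.toStage13Params = theta13LiveOfNumerics F N n ε₂₉ ζ Rz Zt)
    (hn : n.Pos) (hε' : 0 < ε₂₉) (hκ : 0 ≤ n.s2.lf.κ) (hE₀ : 0 ≤ n.s2.lf.E₀) (hB₀ : 0 ≤ n.s2.lf.B₀) (hM : 1 ≤ n.τ9.M) (hrec : θ.Provisos₁₃CoPH F N)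
    {γ' : ℝ} (hγ' : 0 < γ') (hN : ∀ P : B12.RunParams, Step.InInterval γ' P.K (gOfRecord₁₃ F N θ.toStage13Params P) → SupplyChainAt θ P) :
    B16.Thm1Printed (datumOfRecord₁₃CoPH F N θ hrec).C :=
  thm1Printed_datumOfRecord₁₃CoPH_liveRepinH_of_supplyChainAt_family (θ₀ := theta13OfNumerics F N n ε₂₉ ζ Rz Zt) hθ (admissible_theta13OfNumerics F N ζ Rz Zt hn hε')
    hκ hE₀ hB₀ hM hrec hγ' hN

/-- **★★ THE `h11`-SHAPED FAMILY AT THE SepCoPH DATUM OF ANY H-EXTENSION OF `θ₁₃(n, ε₂₉)` FROM A FAMILY OF TOKENS ON THE STEP WINDOW `]0, γ′]`, `0 < γ′`** (`γ₁₁ := γ′`).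
[cite: Balaban1988Convergent, Theorem p.245, Thm 1 p.262, remark p.262, p.244 L36–38, §3 p.279; Balaban1989LargeFieldII, Thm 1 + (0.1) pp.355–356; Balaban1989LargeFieldI, (0.3)–(0.4) p.176] -/
theorem h11Family_theta13LiveOfNumericsH_of_supplyChainAt_family (hθ : θ.toStage13Params = theta13LiveOfNumerics F N n ε₂₉ ζ Rz Zt) (hn : n.Pos)
    (hε' : 0 < ε₂₉) (hκ : 0 ≤ n.s2.lf.κ) (hE₀ : 0 ≤ n.s2.lf.E₀) (hB₀ : 0 ≤ n.s2.lf.B₀) (hM : 1 ≤ n.τ9.M) (hrec : θ.Provisos₁₃SepCoPH F N) {γ' : ℝ} (hγ' : 0 < γ')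
    (hN : ∀ P : B12.RunParams, Step.InInterval γ' P.K (gOfRecord₁₃ F N θ.toStage13Params P) → SupplyChainAt θ P) :
    ∀ βup β₀ : ℝ, ∃ γ₁₁ : ℝ, 0 < γ₁₁ ∧ ∀ w : WorldP, w.C = (datumOfRecord₁₃SepCoPH F N θ hrec).C → w.βup = βup → w.β₀ = β₀ → w.γ ≤ γ₁₁ →
      ∀ P : B12.RunParams, (leavesP w P).b7 → (leavesP w P).b8 → (leavesP w P).b9 → (leavesP w P).b10 → (leavesP w P).b11 →
      (leavesP w P).smallCouplings → (leavesP w P).smallFieldInductive → (leavesP w P).flowControl →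
        ∀ k, k < P.K → SLaw₁₃CoPH F N θ P k → TLaw₁₃CoPH F N θ P k :=
  h11Family_liveRepinH_of_supplyChainAt_family (θ₀ := theta13OfNumerics F N n ε₂₉ ζ Rz Zt) hθ (admissible_theta13OfNumerics F N ζ Rz Zt hn hε')
    hκ hE₀ hB₀ hM hrec hγ' hN

end Numerics

/-! ## §3  At K1's witness of record `θ₁₅ᶜᶜᴹᵂ(j; γ) = theta13OfThm1CCMW F N j γ ε₀ ε₂₉ B₃ B₃' a₀ a₁`: the window `0 < γ ≤ ½` and the six signs ONLY -/

section K1Witness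

variable {j : ℕ} {γ ε₀ ε₂₉ B₃ B₃' a₀ a₁ : ℝ} {θ : Stage13HParams F N}

/-- **★ N11's DAG NODE AT EVERY RUN AT ANY H-EXTENSION OF K1's WITNESS `θ₁₅ᶜᶜᴹᵂ(j; γ)` FROM A FAMILY OF TOKENS ON THE STEP WINDOW `]0, γ′]`** — world bound to the CoPH datum
(`hrec` the key), `w.γ ≤ γ′`; window `0 < γ ≤ ½` + six signs (`stage12NumericsOfThm1CCMW_pos_of_le_half`; numerals `κ = 2·10⁴`, `E₀ = B₀ = 1`, `M = L^j ≥ 1`).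
[cite: Balaban1988Convergent, Thm 1 p.262, Theorem p.245, p.244 L36–38, §3 p.279, (2.4) p.255, (2.10) p.256; Balaban1987RG1, Thm 1 p.259; Balaban1989LargeFieldI, (0.3)–(0.4) p.176, p.177 (i)–(ii)] -/
theorem b14_main_leavesP_all_theta13OfThm1CCMWH_of_supplyChainAt_family (hθ : θ.toStage13Params = theta13OfThm1CCMW F N j γ ε₀ ε₂₉ B₃ B₃' a₀ a₁)
    (hγ₀ : 0 < γ) (hγh : γ ≤ 1 / 2) (hε : 0 < ε₀) (hε' : 0 < ε₂₉) (hB : 0 ≤ B₃) (hB' : 0 ≤ B₃') (ha₀ : 0 < a₀) (ha₁ : 0 < a₁) (hrec : θ.Provisos₁₃CoPH F N)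
    {γ' : ℝ} (hN : ∀ P : B12.RunParams, Step.InInterval γ' P.K (gOfRecord₁₃ F N θ.toStage13Params P) → SupplyChainAt θ P)
    (w : WorldP) (hC : w.C = (datumOfRecord₁₃CoPH F N θ hrec).C) (hγw : w.γ ≤ γ') : ∀ P : B12.RunParams, Dag.B14_main (leavesP w P) :=
  b14_main_leavesP_all_theta13LiveOfNumericsH_of_supplyChainAt_family hθ (stage12NumericsOfThm1CCMW_pos_of_le_half F.hL.2.le hγ₀ hγh hε hB hB' ha₀ ha₁) hε'
    (by rw [show (stage12NumericsOfThm1CCMW F.L j γ ε₀ B₃ B₃' a₀ a₁).s2.lf.κ = 20000 from rfl]; norm_num)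
    (by rw [show (stage12NumericsOfThm1CCMW F.L j γ ε₀ B₃ B₃' a₀ a₁).s2.lf.E₀ = 1 from rfl]; norm_num)
    (by rw [show (stage12NumericsOfThm1CCMW F.L j γ ε₀ B₃ B₃' a₀ a₁).s2.lf.B₀ = 1 from rfl]; norm_num)
    (one_le_M_stage12NumericsOfThm1CCMW F j γ ε₀ B₃ B₃' a₀ a₁) hrec hN w hC hγw

/-- **★ `B16.Thm1Printed` AT THE CoPH DATUM OF ANY H-EXTENSION OF `θ₁₅ᶜᶜᴹᵂ(j; γ)` FROM A FAMILY OF TOKENS ON THE STEP WINDOW `]0, γ′]`, `0 < γ′`** (window `0 < γ ≤ ½` + six signs).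
[cite: Balaban1988Convergent, Thm 1 p.262, Theorem p.245, p.244 L36–38, §3 p.279; Balaban1989LargeFieldII, Thm 1 p.355; Balaban1987RG1, Thm 1 p.259; Balaban1989LargeFieldI, (0.3)–(0.4) p.176] -/
theorem thm1Printed_datumOfRecord₁₃CoPH_theta13OfThm1CCMWH_of_supplyChainAt_family (hθ : θ.toStage13Params = theta13OfThm1CCMW F N j γ ε₀ ε₂₉ B₃ B₃' a₀ a₁)
    (hγ₀ : 0 < γ) (hγh : γ ≤ 1 / 2) (hε : 0 < ε₀) (hε' : 0 < ε₂₉) (hB : 0 ≤ B₃) (hB' : 0 ≤ B₃') (ha₀ : 0 < a₀) (ha₁ : 0 < a₁) (hrec : θ.Provisos₁₃CoPH F N)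
    {γ' : ℝ} (hγ' : 0 < γ') (hN : ∀ P : B12.RunParams, Step.InInterval γ' P.K (gOfRecord₁₃ F N θ.toStage13Params P) → SupplyChainAt θ P) :
    B16.Thm1Printed (datumOfRecord₁₃CoPH F N θ hrec).C :=
  thm1Printed_datumOfRecord₁₃CoPH_theta13LiveOfNumericsH_of_supplyChainAt_family hθ (stage12NumericsOfThm1CCMW_pos_of_le_half F.hL.2.le hγ₀ hγh hε hB hB' ha₀ ha₁) hε'
    (by rw [show (stage12NumericsOfThm1CCMW F.L j γ ε₀ B₃ B₃' a₀ a₁).s2.lf.κ = 20000 from rfl]; norm_num)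
    (by rw [show (stage12NumericsOfThm1CCMW F.L j γ ε₀ B₃ B₃' a₀ a₁).s2.lf.E₀ = 1 from rfl]; norm_num)
    (by rw [show (stage12NumericsOfThm1CCMW F.L j γ ε₀ B₃ B₃' a₀ a₁).s2.lf.B₀ = 1 from rfl]; norm_num)
    (one_le_M_stage12NumericsOfThm1CCMW F j γ ε₀ B₃ B₃' a₀ a₁) hrec hγ' hN

/-- **★★ THE `h11`-SHAPED FAMILY AT THE SepCoPH DATUM OF ANY H-EXTENSION OF `θ₁₅ᶜᶜᴹᵂ(j; γ)` FROM A FAMILY OF TOKENS ON THE STEP WINDOW `]0, γ′]`, `0 < γ′`** (`γ₁₁ := γ′`; window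
`0 < γ ≤ ½` + six signs; only `smallCouplings` read). [cite: Balaban1988Convergent, Theorem p.245, Thm 1 p.262, remark p.262, p.244 L36–38, §3 p.279; Balaban1989LargeFieldII, Thm 1 + (0.1) pp.355–356; Balaban1987RG1, Thm 1 p.259; Balaban1989LargeFieldI, (0.3)–(0.4) p.176] -/
theorem h11Family_theta13OfThm1CCMWH_of_supplyChainAt_family (hθ : θ.toStage13Params = theta13OfThm1CCMW F N j γ ε₀ ε₂₉ B₃ B₃' a₀ a₁)
    (hγ₀ : 0 < γ) (hγh : γ ≤ 1 / 2) (hε : 0 < ε₀) (hε' : 0 < ε₂₉) (hB : 0 ≤ B₃) (hB' : 0 ≤ B₃') (ha₀ : 0 < a₀) (ha₁ : 0 < a₁) (hrec : θ.Provisos₁₃SepCoPH F N)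
    {γ' : ℝ} (hγ' : 0 < γ') (hN : ∀ P : B12.RunParams, Step.InInterval γ' P.K (gOfRecord₁₃ F N θ.toStage13Params P) → SupplyChainAt θ P) :
    ∀ βup β₀ : ℝ, ∃ γ₁₁ : ℝ, 0 < γ₁₁ ∧ ∀ w : WorldP, w.C = (datumOfRecord₁₃SepCoPH F N θ hrec).C → w.βup = βup → w.β₀ = β₀ → w.γ ≤ γ₁₁ →
      ∀ P : B12.RunParams, (leavesP w P).b7 → (leavesP w P).b8 → (leavesP w P).b9 → (leavesP w P).b10 → (leavesP w P).b11 →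
      (leavesP w P).smallCouplings → (leavesP w P).smallFieldInductive → (leavesP w P).flowControl →
        ∀ k, k < P.K → SLaw₁₃CoPH F N θ P k → TLaw₁₃CoPH F N θ P k :=
  h11Family_theta13LiveOfNumericsH_of_supplyChainAt_family hθ (stage12NumericsOfThm1CCMW_pos_of_le_half F.hL.2.le hγ₀ hγh hε hB hB' ha₀ ha₁) hε'
    (by rw [show (stage12NumericsOfThm1CCMW F.L j γ ε₀ B₃ B₃' a₀ a₁).s2.lf.κ = 20000 from rfl]; norm_num)
    (by rw [show (stage12NumericsOfThm1CCMW F.L j γ ε₀ B₃ B₃' a₀ a₁).s2.lf.E₀ = 1 from rfl]; norm_num)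
    (by rw [show (stage12NumericsOfThm1CCMW F.L j γ ε₀ B₃ B₃' a₀ a₁).s2.lf.B₀ = 1 from rfl]; norm_num)
    (one_le_M_stage12NumericsOfThm1CCMW F j γ ε₀ B₃ B₃' a₀ a₁) hrec hγ' hN

end K1Witness

/-! ## §4  At dag-n11-w6's certificate `θᴳ := gaussPinH (Stage13HParams.ofHistoryBlind F N ⟨θ₁₅ᶜᶜᴹᵂ, Zr⟩)` of K1's witness: the `h11` child from the windowed token family; its continuity-road edition -/

section Certificate

variable {j : ℕ} {γ ε₀ ε₂₉ B₃ B₃' a₀ a₁ : ℝ} (Zr : (q : B12.RunParams) → TkResidualW F N (FluctV N) q.K)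

/-- **★★★ N11's CHILD FAMILY IN dag-n24-c's `h11` SHAPE AT `θᴳ`'s SepCoPH DATUM FROM A FAMILY OF TOKENS ON THE STEP WINDOW `]0, γ′]`, `0 < γ′`** (any door proof `hG` keys the datum;
`γ₁₁ := γ′`; window `0 < γ ≤ ½` + six signs): dag-n11-w6's `N11_h11_gaussPinH_ofHistoryBlind_theta13OfThm1CCMW_of_laws` reads the ALL-RUNS `hT`; here the window IS read and the token
is asked on windowed runs only — what the supplier roads deliver.  `θᴳ.toStage13Params = θ₁₅ᶜᶜᴹᵂ` (`rfl`). [cite: Balaban1988Convergent, Theorem p.245, Thm 1 p.262, remark p.262, p.244 L36–38, §3 p.279, (3.16) p.268; Balaban1989LargeFieldII, Thm 1 + (0.1) pp.355–356; Balaban1987RG1, Thm 1 p.259; Balaban1989LargeFieldI, (0.3)–(0.4) p.176] -/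
theorem h11Family_gaussPinH_ofHistoryBlind_theta13OfThm1CCMW_of_supplyChainAt_family (hγ₀ : 0 < γ) (hγh : γ ≤ 1 / 2) (hε : 0 < ε₀) (hε' : 0 < ε₂₉)
    (hB : 0 ≤ B₃) (hB' : 0 ≤ B₃') (ha₀ : 0 < a₀) (ha₁ : 0 < a₁)
    (hG : (gaussPinH (Stage13HParams.ofHistoryBlind F N ⟨theta13OfThm1CCMW F N j γ ε₀ ε₂₉ B₃ B₃' a₀ a₁, Zr⟩)).Provisos₁₃SepCoPH F N) {γ' : ℝ} (hγ' : 0 < γ')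
    (hN : ∀ P : B12.RunParams, Step.InInterval γ' P.K (gOfRecord₁₃ F N (theta13OfThm1CCMW F N j γ ε₀ ε₂₉ B₃ B₃' a₀ a₁) P) →
      SupplyChainAt (gaussPinH (Stage13HParams.ofHistoryBlind F N ⟨theta13OfThm1CCMW F N j γ ε₀ ε₂₉ B₃ B₃' a₀ a₁, Zr⟩)) P) :
    ∀ βup β₀ : ℝ, ∃ γ₁₁ : ℝ, 0 < γ₁₁ ∧ ∀ w : WorldP,
      w.C = (datumOfRecord₁₃SepCoPH F N (gaussPinH (Stage13HParams.ofHistoryBlind F N ⟨theta13OfThm1CCMW F N j γ ε₀ ε₂₉ B₃ B₃' a₀ a₁, Zr⟩)) hG).C →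
      w.βup = βup → w.β₀ = β₀ → w.γ ≤ γ₁₁ → ∀ P : B12.RunParams, (leavesP w P).b7 → (leavesP w P).b8 → (leavesP w P).b9 → (leavesP w P).b10 → (leavesP w P).b11 →
      (leavesP w P).smallCouplings → (leavesP w P).smallFieldInductive → (leavesP w P).flowControl →
        ∀ k, k < P.K → SLaw₁₃CoPH F N (gaussPinH (Stage13HParams.ofHistoryBlind F N ⟨theta13OfThm1CCMW F N j γ ε₀ ε₂₉ B₃ B₃' a₀ a₁, Zr⟩)) P k →
          TLaw₁₃CoPH F N (gaussPinH (Stage13HParams.ofHistoryBlind F N ⟨theta13OfThm1CCMW F N j γ ε₀ ε₂₉ B₃ B₃' a₀ a₁, Zr⟩)) P k :=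
  h11Family_theta13OfThm1CCMWH_of_supplyChainAt_family (θ := gaussPinH (Stage13HParams.ofHistoryBlind F N ⟨theta13OfThm1CCMW F N j γ ε₀ ε₂₉ B₃ B₃' a₀ a₁, Zr⟩))
    rfl hγ₀ hγh hε hε' hB hB' ha₀ ha₁ hG hγ' hN

/-- **★★★ N11's CHILD FAMILY IN dag-n24-c's `h11` SHAPE AT `θᴳ`'s SepCoPH DATUM ON THE CONTINUITY ROAD** — from, PER WINDOWED RUN (`Step.InInterval γ′ P.K (gOfRecord₁₃ θ₁₅ᶜᶜᴹᵂ P)`,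
`0 < γ′`), [III] §3's supplier `σ P` at `θᴳ` with `SupplierObligations` whose chain terms are CONTINUOUS in the configuration (resp. (configuration, fluctuation)) with the two displayed
real-part BOUNDS (this seat's G rows), the door key `hG` (its core keys the certificate class: `gaussPinH_ζ0 ∕ _quad` are `rfl`) — NOTHING ELSE: no `cR`, no K0 row, no bg fact, no run
guard, no operand row; window `0 < γ ≤ ½` + six signs; `γ₁₁ := γ′`.  THE HONEST STATE of N11's K1-road child at K1's witness certificate on the continuity road: the ONE displayed
analytic binder is [III] §3's supplier with its obligations and continuous bounded terms (Thm 2 proper — XL, nobody's theorem). [cite: Balaban1988Convergent, Theorem p.245, Thm 1 p.262, remark p.262, p.244 L36–38, §3 p.279, (3.16)–(3.21) pp.268–269, (3.23)–(3.25) p.270; Balaban1989LargeFieldII, Thm 1 + (0.1) pp.355–356; Balaban1987RG1, Thm 1 p.259; Balaban1989LargeFieldI, (0.3)–(0.4) p.176, p.177 (i)–(ii)] -/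
theorem h11Family_gaussPinH_ofHistoryBlind_theta13OfThm1CCMW_of_continuous (hγ₀ : 0 < γ) (hγh : γ ≤ 1 / 2) (hε : 0 < ε₀) (hε' : 0 < ε₂₉)
    (hB : 0 ≤ B₃) (hB' : 0 ≤ B₃') (ha₀ : 0 < a₀) (ha₁ : 0 < a₁)
    (hG : (gaussPinH (Stage13HParams.ofHistoryBlind F N ⟨theta13OfThm1CCMW F N j γ ε₀ ε₂₉ B₃ B₃' a₀ a₁, Zr⟩)).Provisos₁₃SepCoPH F N) {γ' : ℝ} (hγ' : 0 < γ')
    (σ : (P : B12.RunParams) → Sect3Supplier (gaussPinH (Stage13HParams.ofHistoryBlind F N ⟨theta13OfThm1CCMW F N j γ ε₀ ε₂₉ B₃ B₃' a₀ a₁, Zr⟩)) P)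
    (hσ : ∀ P : B12.RunParams, Step.InInterval γ' P.K (gOfRecord₁₃ F N (theta13OfThm1CCMW F N j γ ε₀ ε₂₉ B₃ B₃' a₀ a₁) P) →
      SupplierObligations (gaussPinH (Stage13HParams.ofHistoryBlind F N ⟨theta13OfThm1CCMW F N j γ ε₀ ε₂₉ B₃ B₃' a₀ a₁, Zr⟩)) P (σ P))
    (hE : ∀ P : B12.RunParams, Step.InInterval γ' P.K (gOfRecord₁₃ F N (theta13OfThm1CCMW F N j γ ε₀ ε₂₉ B₃ B₃' a₀ a₁) P) →
      ∀ (k : ℕ) (s : SeqOfRecord F (theta13OfThm1CCMW F N j γ ε₀ ε₂₉ B₃ B₃' a₀ a₁).ν (theta13OfThm1CCMW F N j γ ε₀ ε₂₉ B₃ B₃' a₀ a₁).τ9.M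
        (gOfRecord₁₃ F N (theta13OfThm1CCMW F N j γ ε₀ ε₂₉ B₃ B₃' a₀ a₁) P) P.K (k + 1)) (i : ℕ), 1 ≤ i →
      ∀ (X : (Sect2.domSys (F.P P.K) (theta13OfThm1CCMW F N j γ ε₀ ε₂₉ B₃ B₃' a₀ a₁).τ9.M i).Dom) (z : Site (F.P P.K) i) (g' : ℝ),
      Continuous (fun U : GaugeField (F.P P.K) 0 (SU N) =>
        ((σ P k (chainWitness _ P (σ P) k).1 (chainWitness _ P (σ P) k).2).1 s).E i X z g'
          (Sect2.ofBackgroundC (settingOfRecord₁₃ F N (theta13OfThm1CCMW F N j γ ε₀ ε₂₉ B₃ B₃' a₀ a₁) P).ι U)))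
    (hCE : ∀ P : B12.RunParams, Step.InInterval γ' P.K (gOfRecord₁₃ F N (theta13OfThm1CCMW F N j γ ε₀ ε₂₉ B₃ B₃' a₀ a₁) P) →
      ∀ (k : ℕ) (s : SeqOfRecord F (theta13OfThm1CCMW F N j γ ε₀ ε₂₉ B₃ B₃' a₀ a₁).ν (theta13OfThm1CCMW F N j γ ε₀ ε₂₉ B₃ B₃' a₀ a₁).τ9.M
        (gOfRecord₁₃ F N (theta13OfThm1CCMW F N j γ ε₀ ε₂₉ B₃ B₃' a₀ a₁) P) P.K (k + 1)) (i : ℕ), 1 ≤ i → ∃ CE : ℝ,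
      ∀ (X : (Sect2.domSys (F.P P.K) (theta13OfThm1CCMW F N j γ ε₀ ε₂₉ B₃ B₃' a₀ a₁).τ9.M i).Dom) (z : Site (F.P P.K) i) (g' : ℝ) (U : GaugeField (F.P P.K) 0 (SU N)),
      |(((σ P k (chainWitness _ P (σ P) k).1 (chainWitness _ P (σ P) k).2).1 s).E i X z g'
          (Sect2.ofBackgroundC (settingOfRecord₁₃ F N (theta13OfThm1CCMW F N j γ ε₀ ε₂₉ B₃ B₃' a₀ a₁) P).ι U)).re| ≤ CE)
    (hR : ∀ P : B12.RunParams, Step.InInterval γ' P.K (gOfRecord₁₃ F N (theta13OfThm1CCMW F N j γ ε₀ ε₂₉ B₃ B₃' a₀ a₁) P) →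
      ∀ (k : ℕ) (s : SeqOfRecord F (theta13OfThm1CCMW F N j γ ε₀ ε₂₉ B₃ B₃' a₀ a₁).ν (theta13OfThm1CCMW F N j γ ε₀ ε₂₉ B₃ B₃' a₀ a₁).τ9.M
        (gOfRecord₁₃ F N (theta13OfThm1CCMW F N j γ ε₀ ε₂₉ B₃ B₃' a₀ a₁) P) P.K (k + 1)) (i : ℕ), 1 ≤ i →
      ∀ X : (Sect2.domSys (F.P P.K) (theta13OfThm1CCMW F N j γ ε₀ ε₂₉ B₃ B₃' a₀ a₁).τ9.M i).Dom,
      Continuous (fun U : GaugeField (F.P P.K) 0 (SU N) =>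
        ((σ P k (chainWitness _ P (σ P) k).1 (chainWitness _ P (σ P) k).2).1 s).R i X
          (Sect2.ofBackgroundC (settingOfRecord₁₃ F N (theta13OfThm1CCMW F N j γ ε₀ ε₂₉ B₃ B₃' a₀ a₁) P).ι U)))
    (hB9 : ∀ P : B12.RunParams, Step.InInterval γ' P.K (gOfRecord₁₃ F N (theta13OfThm1CCMW F N j γ ε₀ ε₂₉ B₃ B₃' a₀ a₁) P) →
      ∀ (k : ℕ) (s : SeqOfRecord F (theta13OfThm1CCMW F N j γ ε₀ ε₂₉ B₃ B₃' a₀ a₁).ν (theta13OfThm1CCMW F N j γ ε₀ ε₂₉ B₃ B₃' a₀ a₁).τ9.M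
        (gOfRecord₁₃ F N (theta13OfThm1CCMW F N j γ ε₀ ε₂₉ B₃ B₃' a₀ a₁) P) P.K (k + 1)) (S' : ℕ → Set (Site (F.P P.K) 0)) (i : ℕ)
        (X : (Sect2.domSys (F.P P.K) (theta13OfThm1CCMW F N j γ ε₀ ε₂₉ B₃ B₃' a₀ a₁).τ9.M i).Dom),
      Continuous (fun q : GaugeField (F.P P.K) 0 (SU N) × MSFluct (F.P P.K) (FluctV N) =>
        ((σ P k (chainWitness _ P (σ P) k).1 (chainWitness _ P (σ P) k).2).1 s).B i X
          (Sect2.ofBackgroundC (settingOfRecord₁₃ F N (theta13OfThm1CCMW F N j γ ε₀ ε₂₉ B₃ B₃' a₀ a₁) P).ι q.1) (S', q.2)))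
    (hCB : ∀ P : B12.RunParams, Step.InInterval γ' P.K (gOfRecord₁₃ F N (theta13OfThm1CCMW F N j γ ε₀ ε₂₉ B₃ B₃' a₀ a₁) P) →
      ∀ (k : ℕ) (s : SeqOfRecord F (theta13OfThm1CCMW F N j γ ε₀ ε₂₉ B₃ B₃' a₀ a₁).ν (theta13OfThm1CCMW F N j γ ε₀ ε₂₉ B₃ B₃' a₀ a₁).τ9.M
        (gOfRecord₁₃ F N (theta13OfThm1CCMW F N j γ ε₀ ε₂₉ B₃ B₃' a₀ a₁) P) P.K (k + 1)) (i : ℕ), 1 ≤ i → ∃ CB : ℝ,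
      ∀ (X : (Sect2.domSys (F.P P.K) (theta13OfThm1CCMW F N j γ ε₀ ε₂₉ B₃ B₃' a₀ a₁).τ9.M i).Dom) (U : GaugeField (F.P P.K) 0 (SU N)) (a : Tk.SFluct (F.P P.K) (FluctV N)),
      |(((σ P k (chainWitness _ P (σ P) k).1 (chainWitness _ P (σ P) k).2).1 s).B i X
          (Sect2.ofBackgroundC (settingOfRecord₁₃ F N (theta13OfThm1CCMW F N j γ ε₀ ε₂₉ B₃ B₃' a₀ a₁) P).ι U) a).re| ≤ CB) :
    ∀ βup β₀ : ℝ, ∃ γ₁₁ : ℝ, 0 < γ₁₁ ∧ ∀ w : WorldP,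
      w.C = (datumOfRecord₁₃SepCoPH F N (gaussPinH (Stage13HParams.ofHistoryBlind F N ⟨theta13OfThm1CCMW F N j γ ε₀ ε₂₉ B₃ B₃' a₀ a₁, Zr⟩)) hG).C →
      w.βup = βup → w.β₀ = β₀ → w.γ ≤ γ₁₁ → ∀ P : B12.RunParams, (leavesP w P).b7 → (leavesP w P).b8 → (leavesP w P).b9 → (leavesP w P).b10 → (leavesP w P).b11 →
      (leavesP w P).smallCouplings → (leavesP w P).smallFieldInductive → (leavesP w P).flowControl →
        ∀ k, k < P.K → SLaw₁₃CoPH F N (gaussPinH (Stage13HParams.ofHistoryBlind F N ⟨theta13OfThm1CCMW F N j γ ε₀ ε₂₉ B₃ B₃' a₀ a₁, Zr⟩)) P k →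
          TLaw₁₃CoPH F N (gaussPinH (Stage13HParams.ofHistoryBlind F N ⟨theta13OfThm1CCMW F N j γ ε₀ ε₂₉ B₃ B₃' a₀ a₁, Zr⟩)) P k :=
  h11Family_gaussPinH_ofHistoryBlind_theta13OfThm1CCMW_of_supplyChainAt_family Zr hγ₀ hγh hε hε' hB hB' ha₀ ha₁ hG hγ'
    (supplyChainAt_family_of_gaussCert_of_continuous (gaussPinH (Stage13HParams.ofHistoryBlind F N ⟨theta13OfThm1CCMW F N j γ ε₀ ε₂₉ B₃ B₃' a₀ a₁, Zr⟩))
      (gaussPinH_ζ0 _) (gaussPinH_quad _) hG.toCore (one_le_M_stage12NumericsOfThm1CCMW F j γ ε₀ B₃ B₃' a₀ a₁) σ hσ hE hCE hR hB9 hCB)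

/-- **★★ N11's DAG NODE AT EVERY RUN AT A WORLD BOUND TO `θᴳ`'s CoPH DATUM ON THE CONTINUITY ROAD** (`w.γ ≤ γ′`; door core `hrec` keys the datum; window `0 < γ ≤ ½` + six signs):
from, per windowed run, [III] §3's supplier at `θᴳ` with `SupplierObligations` and continuous bounded terms — NOTHING ELSE displayed.  `βup ∕ β₀ ∕ b ∕ gR ∕ up` UNREAD.
[cite: Balaban1988Convergent, Thm 1 p.262, Theorem p.245, p.244 L36–38, §3 p.279, (3.16)–(3.21) pp.268–269, (3.23)–(3.25) p.270; Balaban1989LargeFieldII, Introduction pp.355–356; Balaban1987RG1, Thm 1 p.259; Balaban1989LargeFieldI, (0.3)–(0.4) p.176, p.177 (i)–(ii)] -/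
theorem b14_main_leavesP_all_gaussPinH_ofHistoryBlind_theta13OfThm1CCMW_of_continuous (hγ₀ : 0 < γ) (hγh : γ ≤ 1 / 2) (hε : 0 < ε₀) (hε' : 0 < ε₂₉)
    (hB : 0 ≤ B₃) (hB' : 0 ≤ B₃') (ha₀ : 0 < a₀) (ha₁ : 0 < a₁)
    (hrec : (gaussPinH (Stage13HParams.ofHistoryBlind F N ⟨theta13OfThm1CCMW F N j γ ε₀ ε₂₉ B₃ B₃' a₀ a₁, Zr⟩)).Provisos₁₃CoPH F N) {γ' : ℝ}
    (σ : (P : B12.RunParams) → Sect3Supplier (gaussPinH (Stage13HParams.ofHistoryBlind F N ⟨theta13OfThm1CCMW F N j γ ε₀ ε₂₉ B₃ B₃' a₀ a₁, Zr⟩)) P)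
    (hσ : ∀ P : B12.RunParams, Step.InInterval γ' P.K (gOfRecord₁₃ F N (theta13OfThm1CCMW F N j γ ε₀ ε₂₉ B₃ B₃' a₀ a₁) P) →
      SupplierObligations (gaussPinH (Stage13HParams.ofHistoryBlind F N ⟨theta13OfThm1CCMW F N j γ ε₀ ε₂₉ B₃ B₃' a₀ a₁, Zr⟩)) P (σ P))
    (hE : ∀ P : B12.RunParams, Step.InInterval γ' P.K (gOfRecord₁₃ F N (theta13OfThm1CCMW F N j γ ε₀ ε₂₉ B₃ B₃' a₀ a₁) P) →
      ∀ (k : ℕ) (s : SeqOfRecord F (theta13OfThm1CCMW F N j γ ε₀ ε₂₉ B₃ B₃' a₀ a₁).ν (theta13OfThm1CCMW F N j γ ε₀ ε₂₉ B₃ B₃' a₀ a₁).τ9.M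
        (gOfRecord₁₃ F N (theta13OfThm1CCMW F N j γ ε₀ ε₂₉ B₃ B₃' a₀ a₁) P) P.K (k + 1)) (i : ℕ), 1 ≤ i →
      ∀ (X : (Sect2.domSys (F.P P.K) (theta13OfThm1CCMW F N j γ ε₀ ε₂₉ B₃ B₃' a₀ a₁).τ9.M i).Dom) (z : Site (F.P P.K) i) (g' : ℝ),
      Continuous (fun U : GaugeField (F.P P.K) 0 (SU N) =>
        ((σ P k (chainWitness _ P (σ P) k).1 (chainWitness _ P (σ P) k).2).1 s).E i X z g'
          (Sect2.ofBackgroundC (settingOfRecord₁₃ F N (theta13OfThm1CCMW F N j γ ε₀ ε₂₉ B₃ B₃' a₀ a₁) P).ι U)))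
    (hCE : ∀ P : B12.RunParams, Step.InInterval γ' P.K (gOfRecord₁₃ F N (theta13OfThm1CCMW F N j γ ε₀ ε₂₉ B₃ B₃' a₀ a₁) P) →
      ∀ (k : ℕ) (s : SeqOfRecord F (theta13OfThm1CCMW F N j γ ε₀ ε₂₉ B₃ B₃' a₀ a₁).ν (theta13OfThm1CCMW F N j γ ε₀ ε₂₉ B₃ B₃' a₀ a₁).τ9.M
        (gOfRecord₁₃ F N (theta13OfThm1CCMW F N j γ ε₀ ε₂₉ B₃ B₃' a₀ a₁) P) P.K (k + 1)) (i : ℕ), 1 ≤ i → ∃ CE : ℝ,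
      ∀ (X : (Sect2.domSys (F.P P.K) (theta13OfThm1CCMW F N j γ ε₀ ε₂₉ B₃ B₃' a₀ a₁).τ9.M i).Dom) (z : Site (F.P P.K) i) (g' : ℝ) (U : GaugeField (F.P P.K) 0 (SU N)),
      |(((σ P k (chainWitness _ P (σ P) k).1 (chainWitness _ P (σ P) k).2).1 s).E i X z g'
          (Sect2.ofBackgroundC (settingOfRecord₁₃ F N (theta13OfThm1CCMW F N j γ ε₀ ε₂₉ B₃ B₃' a₀ a₁) P).ι U)).re| ≤ CE)
    (hR : ∀ P : B12.RunParams, Step.InInterval γ' P.K (gOfRecord₁₃ F N (theta13OfThm1CCMW F N j γ ε₀ ε₂₉ B₃ B₃' a₀ a₁) P) →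
      ∀ (k : ℕ) (s : SeqOfRecord F (theta13OfThm1CCMW F N j γ ε₀ ε₂₉ B₃ B₃' a₀ a₁).ν (theta13OfThm1CCMW F N j γ ε₀ ε₂₉ B₃ B₃' a₀ a₁).τ9.M
        (gOfRecord₁₃ F N (theta13OfThm1CCMW F N j γ ε₀ ε₂₉ B₃ B₃' a₀ a₁) P) P.K (k + 1)) (i : ℕ), 1 ≤ i →
      ∀ X : (Sect2.domSys (F.P P.K) (theta13OfThm1CCMW F N j γ ε₀ ε₂₉ B₃ B₃' a₀ a₁).τ9.M i).Dom,
      Continuous (fun U : GaugeField (F.P P.K) 0 (SU N) =>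
        ((σ P k (chainWitness _ P (σ P) k).1 (chainWitness _ P (σ P) k).2).1 s).R i X
          (Sect2.ofBackgroundC (settingOfRecord₁₃ F N (theta13OfThm1CCMW F N j γ ε₀ ε₂₉ B₃ B₃' a₀ a₁) P).ι U)))
    (hB9 : ∀ P : B12.RunParams, Step.InInterval γ' P.K (gOfRecord₁₃ F N (theta13OfThm1CCMW F N j γ ε₀ ε₂₉ B₃ B₃' a₀ a₁) P) →
      ∀ (k : ℕ) (s : SeqOfRecord F (theta13OfThm1CCMW F N j γ ε₀ ε₂₉ B₃ B₃' a₀ a₁).ν (theta13OfThm1CCMW F N j γ ε₀ ε₂₉ B₃ B₃' a₀ a₁).τ9.M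
        (gOfRecord₁₃ F N (theta13OfThm1CCMW F N j γ ε₀ ε₂₉ B₃ B₃' a₀ a₁) P) P.K (k + 1)) (S' : ℕ → Set (Site (F.P P.K) 0)) (i : ℕ)
        (X : (Sect2.domSys (F.P P.K) (theta13OfThm1CCMW F N j γ ε₀ ε₂₉ B₃ B₃' a₀ a₁).τ9.M i).Dom),
      Continuous (fun q : GaugeField (F.P P.K) 0 (SU N) × MSFluct (F.P P.K) (FluctV N) =>
        ((σ P k (chainWitness _ P (σ P) k).1 (chainWitness _ P (σ P) k).2).1 s).B i X
          (Sect2.ofBackgroundC (settingOfRecord₁₃ F N (theta13OfThm1CCMW F N j γ ε₀ ε₂₉ B₃ B₃' a₀ a₁) P).ι q.1) (S', q.2)))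
    (hCB : ∀ P : B12.RunParams, Step.InInterval γ' P.K (gOfRecord₁₃ F N (theta13OfThm1CCMW F N j γ ε₀ ε₂₉ B₃ B₃' a₀ a₁) P) →
      ∀ (k : ℕ) (s : SeqOfRecord F (theta13OfThm1CCMW F N j γ ε₀ ε₂₉ B₃ B₃' a₀ a₁).ν (theta13OfThm1CCMW F N j γ ε₀ ε₂₉ B₃ B₃' a₀ a₁).τ9.M
        (gOfRecord₁₃ F N (theta13OfThm1CCMW F N j γ ε₀ ε₂₉ B₃ B₃' a₀ a₁) P) P.K (k + 1)) (i : ℕ), 1 ≤ i → ∃ CB : ℝ,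
      ∀ (X : (Sect2.domSys (F.P P.K) (theta13OfThm1CCMW F N j γ ε₀ ε₂₉ B₃ B₃' a₀ a₁).τ9.M i).Dom) (U : GaugeField (F.P P.K) 0 (SU N)) (a : Tk.SFluct (F.P P.K) (FluctV N)),
      |(((σ P k (chainWitness _ P (σ P) k).1 (chainWitness _ P (σ P) k).2).1 s).B i X
          (Sect2.ofBackgroundC (settingOfRecord₁₃ F N (theta13OfThm1CCMW F N j γ ε₀ ε₂₉ B₃ B₃' a₀ a₁) P).ι U) a).re| ≤ CB)
    (w : WorldP) (hC : w.C = (datumOfRecord₁₃CoPH F N (gaussPinH (Stage13HParams.ofHistoryBlind F N ⟨theta13OfThm1CCMW F N j γ ε₀ ε₂₉ B₃ B₃' a₀ a₁, Zr⟩)) hrec).C)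
    (hγw : w.γ ≤ γ') : ∀ P : B12.RunParams, Dag.B14_main (leavesP w P) :=
  b14_main_leavesP_all_theta13OfThm1CCMWH_of_supplyChainAt_family (θ := gaussPinH (Stage13HParams.ofHistoryBlind F N ⟨theta13OfThm1CCMW F N j γ ε₀ ε₂₉ B₃ B₃' a₀ a₁, Zr⟩))
    rfl hγ₀ hγh hε hε' hB hB' ha₀ ha₁ hrec
    (supplyChainAt_family_of_gaussCert_of_continuous (gaussPinH (Stage13HParams.ofHistoryBlind F N ⟨theta13OfThm1CCMW F N j γ ε₀ ε₂₉ B₃ B₃' a₀ a₁, Zr⟩))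
      (gaussPinH_ζ0 _) (gaussPinH_quad _) hrec (one_le_M_stage12NumericsOfThm1CCMW F j γ ε₀ B₃ B₃' a₀ a₁) σ hσ hE hCE hR hB9 hCB) w hC hγw

end Certificate

end Summit.QuantumFields.YangMills.Theorems.BalabanUVNodesN11NodeFacesOfSupplyChainTokensAtWitness

end
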